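import Summits.QuantumFields.YangMills.Theorems.BalabanUVNodesN15KingModelReflectionPositivityLaw
import Summits.QuantumFields.YangMills.Theorems.BalabanUVNodesN15KingModelEuclideanDecay
import Literature.NumberTheory.Sieve.BombieriAsymptoticSieveMertens

/-!
# BalabanUVNodes ∕ N15 — THE KING-MODEL RUNG (PART Ϻ-q): EXPONENTIAL CLUSTERING OF THE INFINITE-VOLUME LAW `μ_∞` ON EXPONENTIAL OBSERVABLES —
# `|∫e^{φ(f)}e^{φ(T_vg)}dμ_∞ − ∫e^{φ(f)}dμ_∞∫e^{φ(g)}dμ_∞| ≤ K(f,g,ε)·e^{−(1−ε)m‖v‖₂}` for every `0 < ε ≤ 1` and every translation `v ∈ ℤ^{d+1}` (the mass gap of the MEASURE, isotropic)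
# (Track A, DAG node N15 = NE2; FAN-OUT v1.1 §N15 s3 «KING-MODEL RUNG»; uses parts Ϻ-d (Euclidean clustering of `S₂^{ℝ}`), Ϻ-n∕o (`μ_∞`, exponential moments); count-neutral)

HONEST FRAMING.  Count-neutral (cell `pub-ymgap`, seat `pub-ymgap-dag-n15-e` g35; `--supports stmt-QuantumFields-27366 --as helper` = K3⁸).  King's `A = 0`, `g = 0` model
([King1986] C. King, Commun. Math. Phys. **102** (1986) 649–677).  Part Ϻ-n realised the `K = |Ω| = ∞` block field as the translation-invariant Gaussian measure `μ_∞`; part Ϻ-o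
computed its exponential moments; part Ϻ-d bounded `S₂^{ℝ}(z) ≤ K_εe^{−(1−ε)m‖z‖₂}`.  THIS FILE proves the MIXING ∕ MASS-GAP property of the measure on the exponential algebra:
for field sums `φ(f) = Σ_{j∈T}c_jφ(p_j)`, `φ(g) = Σ_{j′∈T′}c′_{j′}φ(p′_{j′})` and the translate `T_vg` (sites `p′ + v`),
`Cov_{μ_∞}(e^{φ(f)}, e^{φ(T_vg)}) = e^{V_f∕2}e^{V_g∕2}(e^{C_v} − 1)` with `C_v = Σ_{j,j′}c_jc′_{j′}S₂^{ℝ}(p′_{j′} + v − p_j)`, `|C_v| ≤ A·e^{−(1−ε)m‖v‖₂}` (triangle inequality in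
`EuclideanSpace`), `|e^{C} − 1| ≤ |C|e^{|C|}`; hence ★★★ `|Cov| ≤ e^{V_f∕2}e^{V_g∕2}·A e^{A}·e^{−(1−ε)m‖v‖₂}` — EXPONENTIAL CLUSTERING at every rate `(1−ε)m` in every direction, and mixing
(`→ 0` along the cofinite filter).  NOT Bałaban's objects; NOT a node discharge; nothing continuum-Yang–Mills ∕ `ℝ⁴` ∕ OS reconstruction ∕ Clay — the mass gap here is the free
field's `m`, seen on the MEASURE `μ_∞`.  0 `sorry`, 0 def; standard axioms.

WHAT THIS FILE PROVES (kernel).  §1 (the letter `|e^x−1| ≤ |x|e^{|x|}` is the tree's `Literature.NumberTheory.Sieve.BombieriSieve.abs_exp_sub_one_le`, reused by name) ★★ **`integral_exp_mul_exp_fieldSum`** (the joint exponential moment of two field sums, disjoint-sum bookkeeping),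
★★ `cov_exp_fieldSum_eq` (`Cov = e^{V_f∕2}e^{V_g∕2}(e^{C}−1)`).  §2 `norm_shift_le`, ★ `abs_crossForm_shift_le` (`|C_v| ≤ A e^{−(1−ε)m‖v‖₂}`), ★★★ **`abs_cov_exp_shift_le`** (exponential clustering),
★★ **`tendsto_cov_exp_shift`** (mixing along `cofinite`).

HONEST SCOPE.  King's free `K = |Ω| = ∞` block field; observables = real exponentials of finitely supported field sums; constants explicit but not optimised.  N15 untouched; counts
unmoved.  Locators (use): [King1986] Thm 2.1 (2.22) p.654, Thm 3.3 (3.6) p.655.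
-/

noncomputable section

open scoped BigOperators Topology
open Filter MeasureTheory ProbabilityTheory Finset

namespace Summit.QuantumFields.YangMills.BalabanUVNodes.N15KingModelRung.InfiniteVolume

open Summit.QuantumFields.YangMills.BalabanUVNodes.N15KingModelRung.OptimalDecay
open Summit.QuantumFields.YangMills.BalabanUVNodes.N15KingModelRung.ProperTime

variable {d : ℕ} {J J' : Type*}

/-! ## §1 The joint exponential moment of two field sums and the covariance formula -/

/-- ★★ **THE JOINT EXPONENTIAL MOMENT OF TWO FIELD SUMS**: with `V = ΣΣc_jc_kS₂^{ℝ}(p_k−p_j)`, `V′` likewise for `(c′,p′)` and the cross form `C = Σ_{j∈T}Σ_{j′∈T′}c_jc′_{j′}S₂^{ℝ}(p′_{j′}−p_j)`: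
`∫ e^{Σ_{j∈T}c_jφ(p_j)}·e^{Σ_{j′∈T′}c′_{j′}φ(p′_{j′})} dμ_∞ = exp(V∕2 + V′∕2 + C)`. [folklore] -/
theorem integral_exp_mul_exp_fieldSum {m2 : ℝ} (hm : 0 < m2) (T : Finset J) (p : J → Fin (d + 1) → ℤ) (c : J → ℝ) (T' : Finset J') (p' : J' → Fin (d + 1) → ℤ) (c' : J' → ℝ) :
    ∫ ω, Real.exp (∑ j ∈ T, c j * ω (p j)) * Real.exp (∑ j ∈ T', c' j * ω (p' j)) ∂kingFieldInf m2
      = Real.exp ((∑ j ∈ T, ∑ k ∈ T, c j * c k * kingS2Inf m2 (p k - p j)) / 2 + (∑ j ∈ T', ∑ k ∈ T', c' j * c' k * kingS2Inf m2 (p' k - p' j)) / 2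
          + ∑ j ∈ T, ∑ k ∈ T', c j * c' k * kingS2Inf m2 (p' k - p j)) := by
  -- the combined field sum over the disjoint sum of the index sets
  have hfun : (fun ω : (Fin (d + 1) → ℤ) → ℝ => Real.exp (∑ j ∈ T, c j * ω (p j)) * Real.exp (∑ j ∈ T', c' j * ω (p' j)))
      = fun ω => Real.exp (∑ q ∈ T.disjSum T', Sum.elim c c' q * ω (Sum.elim p p' q)) := by
    funext ω
    rw [← Real.exp_add, Finset.sum_disjSum]
    simp
  rw [hfun, integral_exp_fieldSum hm]
  congr 1
  rw [Finset.sum_disjSum]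
  simp only [Finset.sum_disjSum, Sum.elim_inl, Sum.elim_inr, Finset.sum_add_distrib]
  have hcross : ∑ j ∈ T', ∑ k ∈ T, c' j * c k * kingS2Inf m2 (p k - p' j) = ∑ j ∈ T, ∑ k ∈ T', c j * c' k * kingS2Inf m2 (p' k - p j) := by
    rw [Finset.sum_comm]
    refine Finset.sum_congr rfl fun j _ => Finset.sum_congr rfl fun k _ => ?_
    rw [← kingS2Inf_neg m2 (p' k - p j), neg_sub]
    ring
  rw [hcross]
  ring

/-- ★★ **THE COVARIANCE OF TWO EXPONENTIAL OBSERVABLES**: `∫e^{φ(f)}e^{φ(g)} − ∫e^{φ(f)}∫e^{φ(g)} = e^{V∕2}e^{V′∕2}(e^{C} − 1)`. [folklore] -/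
theorem cov_exp_fieldSum_eq {m2 : ℝ} (hm : 0 < m2) (T : Finset J) (p : J → Fin (d + 1) → ℤ) (c : J → ℝ) (T' : Finset J') (p' : J' → Fin (d + 1) → ℤ) (c' : J' → ℝ) :
    (∫ ω, Real.exp (∑ j ∈ T, c j * ω (p j)) * Real.exp (∑ j ∈ T', c' j * ω (p' j)) ∂kingFieldInf m2)
      - (∫ ω, Real.exp (∑ j ∈ T, c j * ω (p j)) ∂kingFieldInf m2) * (∫ ω, Real.exp (∑ j ∈ T', c' j * ω (p' j)) ∂kingFieldInf m2)
      = Real.exp ((∑ j ∈ T, ∑ k ∈ T, c j * c k * kingS2Inf m2 (p k - p j)) / 2) * Real.exp ((∑ j ∈ T', ∑ k ∈ T', c' j * c' k * kingS2Inf m2 (p' k - p' j)) / 2)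
          * (Real.exp (∑ j ∈ T, ∑ k ∈ T', c j * c' k * kingS2Inf m2 (p' k - p j)) - 1) := by
  rw [integral_exp_mul_exp_fieldSum hm, integral_exp_fieldSum hm, integral_exp_fieldSum hm, Real.exp_add, Real.exp_add]
  ring

/-! ## §2 Exponential clustering under translations -/

/-- `‖v‖₂ − ‖p − p′‖₂ ≤ ‖p′ + v − p‖₂` (triangle inequality for the integer vectors read in `EuclideanSpace`). [folklore] -/
theorem norm_shift_ge (p p' v : Fin (d + 1) → ℤ) :
    ‖WithLp.toLp 2 (fun μ => ((v μ : ℤ) : ℝ))‖ - ‖WithLp.toLp 2 (fun μ => (((p - p') μ : ℤ) : ℝ))‖ ≤ ‖WithLp.toLp 2 (fun μ => (((p' + v - p) μ : ℤ) : ℝ))‖ := by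
  have h := norm_add_le (WithLp.toLp 2 (fun μ => (((p' + v - p) μ : ℤ) : ℝ))) (WithLp.toLp 2 (fun μ => (((p - p') μ : ℤ) : ℝ)))
  rw [← WithLp.toLp_add] at h
  have he : ((fun μ => (((p' + v - p) μ : ℤ) : ℝ)) + fun μ => (((p - p') μ : ℤ) : ℝ)) = fun μ => ((v μ : ℤ) : ℝ) := by
    funext μ
    simp only [Pi.add_apply, Pi.sub_apply]
    push_cast
    ring
  rw [he] at h
  linarith

/-- ★ **The cross form decays**: for `0 < ε ≤ 1`, `|Σ_{j,k}c_jc′_kS₂^{ℝ}(p′_k + v − p_j)| ≤ A·e^{−(1−ε)√m²‖v‖₂}` with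
`A = Σ_{j,k}|c_j||c′_k|·K_ε·e^{(1−ε)√m²‖p_j − p′_k‖₂}`, `K_ε` part Ϻ-d's constant. [cite: King1986, Thm 3.3 (3.6) p.655] -/
theorem abs_crossForm_shift_le {m2 ε : ℝ} (hm : 0 < m2) (hε0 : 0 < ε) (hε1 : ε ≤ 1) (T : Finset J) (p : J → Fin (d + 1) → ℤ) (c : J → ℝ)
    (T' : Finset J') (p' : J' → Fin (d + 1) → ℤ) (c' : J' → ℝ) (v : Fin (d + 1) → ℤ) :
    |∑ j ∈ T, ∑ k ∈ T', c j * c' k * kingS2Inf m2 (p' k + v - p j)|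
      ≤ (∑ j ∈ T, ∑ k ∈ T', |c j| * |c' k| * (Real.exp ((1 - ε) * Real.sqrt m2 * (1 + Real.sqrt (d + 1))) * (freePropRadial d (ε * m2) (Real.sqrt ε) + m2⁻¹))
            * Real.exp ((1 - ε) * Real.sqrt m2 * ‖WithLp.toLp 2 (fun μ => (((p j - p' k) μ : ℤ) : ℝ))‖))
          * Real.exp (-((1 - ε) * Real.sqrt m2 * ‖WithLp.toLp 2 (fun μ => ((v μ : ℤ) : ℝ))‖)) := by
  set K : ℝ := Real.exp ((1 - ε) * Real.sqrt m2 * (1 + Real.sqrt (d + 1))) * (freePropRadial d (ε * m2) (Real.sqrt ε) + m2⁻¹) with hK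
  set m : ℝ := Real.sqrt m2 with hmdef
  have hm' : 0 < m := Real.sqrt_pos.mpr hm
  have h1ε : 0 ≤ (1 - ε) * m := mul_nonneg (by linarith) hm'.le
  rw [Finset.sum_mul]
  refine (Finset.abs_sum_le_sum_abs _ _).trans (Finset.sum_le_sum fun j _ => ?_)
  rw [Finset.sum_mul]
  refine (Finset.abs_sum_le_sum_abs _ _).trans (Finset.sum_le_sum fun k _ => ?_)
  rw [abs_mul, abs_mul, abs_of_pos (kingS2Inf_pos hm _)]
  have hS := kingS2Inf_le_const_mul_exp_neg_norm hm hε0 hε1 (p' k + v - p j)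
  have hexp : Real.exp (-((1 - ε) * m * ‖WithLp.toLp 2 (fun μ => (((p' k + v - p j) μ : ℤ) : ℝ))‖))
      ≤ Real.exp ((1 - ε) * m * ‖WithLp.toLp 2 (fun μ => (((p j - p' k) μ : ℤ) : ℝ))‖) * Real.exp (-((1 - ε) * m * ‖WithLp.toLp 2 (fun μ => ((v μ : ℤ) : ℝ))‖)) := by
    rw [← Real.exp_add, Real.exp_le_exp]
    have := mul_le_mul_of_nonneg_left (norm_shift_ge (p j) (p' k) v) h1ε
    nlinarith
  calc |c j| * |c' k| * kingS2Inf m2 (p' k + v - p j)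
      ≤ |c j| * |c' k| * (K * Real.exp (-((1 - ε) * m * ‖WithLp.toLp 2 (fun μ => (((p' k + v - p j) μ : ℤ) : ℝ))‖))) :=
        mul_le_mul_of_nonneg_left hS (by positivity)
    _ ≤ |c j| * |c' k| * (K * (Real.exp ((1 - ε) * m * ‖WithLp.toLp 2 (fun μ => (((p j - p' k) μ : ℤ) : ℝ))‖)
            * Real.exp (-((1 - ε) * m * ‖WithLp.toLp 2 (fun μ => ((v μ : ℤ) : ℝ))‖)))) := by
        have hK0 : 0 ≤ K := by
          have := freePropRadial_pos (d := d) (mul_pos hε0 hm) (Real.sqrt_pos.mpr hε0)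
          positivity
        gcongr
    _ = _ := by ring

/-- ★★★ **EXPONENTIAL CLUSTERING OF `μ_∞` ON EXPONENTIAL OBSERVABLES**: for `0 < ε ≤ 1`, field sums `φ(f) = Σ_{j∈T}c_jφ(p_j)`, `φ(g) = Σ_{k∈T′}c′_kφ(p′_k)` and every translation `v`,
`|∫e^{φ(f)}e^{φ(T_vg)}dμ_∞ − ∫e^{φ(f)}dμ_∞·∫e^{φ(g)}dμ_∞| ≤ e^{V_f∕2}e^{V_g∕2}·A·e^{A}·e^{−(1−ε)√m²‖v‖₂}` (`A` the constant of `abs_crossForm_shift_le`; translation invariance of `μ_∞`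
gives `∫e^{φ(T_vg)} = ∫e^{φ(g)}`). [cite: King1986, Thm 3.3 (3.6) p.655, Thm 2.1 (2.22) p.654] -/
theorem abs_cov_exp_shift_le {m2 ε : ℝ} (hm : 0 < m2) (hε0 : 0 < ε) (hε1 : ε ≤ 1) (T : Finset J) (p : J → Fin (d + 1) → ℤ) (c : J → ℝ)
    (T' : Finset J') (p' : J' → Fin (d + 1) → ℤ) (c' : J' → ℝ) (v : Fin (d + 1) → ℤ) :
    |(∫ ω, Real.exp (∑ j ∈ T, c j * ω (p j)) * Real.exp (∑ k ∈ T', c' k * ω (p' k + v)) ∂kingFieldInf m2)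
        - (∫ ω, Real.exp (∑ j ∈ T, c j * ω (p j)) ∂kingFieldInf m2) * (∫ ω, Real.exp (∑ k ∈ T', c' k * ω (p' k)) ∂kingFieldInf m2)|
      ≤ Real.exp ((∑ j ∈ T, ∑ k ∈ T, c j * c k * kingS2Inf m2 (p k - p j)) / 2) * Real.exp ((∑ j ∈ T', ∑ k ∈ T', c' j * c' k * kingS2Inf m2 (p' k - p' j)) / 2)
        * ((∑ j ∈ T, ∑ k ∈ T', |c j| * |c' k| * (Real.exp ((1 - ε) * Real.sqrt m2 * (1 + Real.sqrt (d + 1))) * (freePropRadial d (ε * m2) (Real.sqrt ε) + m2⁻¹))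
              * Real.exp ((1 - ε) * Real.sqrt m2 * ‖WithLp.toLp 2 (fun μ => (((p j - p' k) μ : ℤ) : ℝ))‖))
          * Real.exp (∑ j ∈ T, ∑ k ∈ T', |c j| * |c' k| * (Real.exp ((1 - ε) * Real.sqrt m2 * (1 + Real.sqrt (d + 1))) * (freePropRadial d (ε * m2) (Real.sqrt ε) + m2⁻¹))
              * Real.exp ((1 - ε) * Real.sqrt m2 * ‖WithLp.toLp 2 (fun μ => (((p j - p' k) μ : ℤ) : ℝ))‖))
          * Real.exp (-((1 - ε) * Real.sqrt m2 * ‖WithLp.toLp 2 (fun μ => ((v μ : ℤ) : ℝ))‖))) := by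
  have hm' : 0 < Real.sqrt m2 := Real.sqrt_pos.mpr hm
  -- the second factor's expectation is translation invariant: rewrite it with the shifted sites
  have hshift : ∫ ω, Real.exp (∑ k ∈ T', c' k * ω (p' k)) ∂kingFieldInf m2 = ∫ ω, Real.exp (∑ k ∈ T', c' k * ω (p' k + v)) ∂kingFieldInf m2 := by
    rw [integral_exp_fieldSum hm, integral_exp_fieldSum hm]
    congr 2
    refine Finset.sum_congr rfl fun j _ => Finset.sum_congr rfl fun k _ => ?_
    rw [add_sub_add_right_eq_sub]
  rw [hshift, cov_exp_fieldSum_eq hm T p c T' (fun k => p' k + v) c']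
  -- the shifted self-form of `g` equals the unshifted one
  have hV' : ∑ j ∈ T', ∑ k ∈ T', c' j * c' k * kingS2Inf m2 (p' k + v - (p' j + v)) = ∑ j ∈ T', ∑ k ∈ T', c' j * c' k * kingS2Inf m2 (p' k - p' j) := by
    refine Finset.sum_congr rfl fun j _ => Finset.sum_congr rfl fun k _ => ?_
    rw [add_sub_add_right_eq_sub]
  rw [hV']
  set A : ℝ := ∑ j ∈ T, ∑ k ∈ T', |c j| * |c' k| * (Real.exp ((1 - ε) * Real.sqrt m2 * (1 + Real.sqrt (d + 1))) * (freePropRadial d (ε * m2) (Real.sqrt ε) + m2⁻¹))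
      * Real.exp ((1 - ε) * Real.sqrt m2 * ‖WithLp.toLp 2 (fun μ => (((p j - p' k) μ : ℤ) : ℝ))‖) with hA
  set C : ℝ := ∑ j ∈ T, ∑ k ∈ T', c j * c' k * kingS2Inf m2 (p' k + v - p j) with hC
  set E₁ : ℝ := Real.exp ((∑ j ∈ T, ∑ k ∈ T, c j * c k * kingS2Inf m2 (p k - p j)) / 2) with hE₁
  set E₂ : ℝ := Real.exp ((∑ j ∈ T', ∑ k ∈ T', c' j * c' k * kingS2Inf m2 (p' k - p' j)) / 2) with hE₂
  have hCA : |C| ≤ A * Real.exp (-((1 - ε) * Real.sqrt m2 * ‖WithLp.toLp 2 (fun μ => ((v μ : ℤ) : ℝ))‖)) := abs_crossForm_shift_le hm hε0 hε1 T p c T' p' c' v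
  have hA0 : 0 ≤ A := by
    have := freePropRadial_pos (d := d) (mul_pos hε0 hm) (Real.sqrt_pos.mpr hε0)
    rw [hA]
    exact Finset.sum_nonneg fun j _ => Finset.sum_nonneg fun k _ => by positivity
  have hCle : |C| ≤ A := hCA.trans (mul_le_of_le_one_right hA0 (by
    rw [Real.exp_le_one_iff, neg_nonpos]
    exact mul_nonneg (mul_nonneg (by linarith) hm'.le) (norm_nonneg _)))
  rw [abs_mul, abs_mul, abs_of_pos (Real.exp_pos _), abs_of_pos (Real.exp_pos _)]
  have hexp1 := Literature.NumberTheory.Sieve.BombieriSieve.abs_exp_sub_one_le C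
  calc E₁ * E₂ * |Real.exp C - 1| ≤ E₁ * E₂ * (|C| * Real.exp |C|) := mul_le_mul_of_nonneg_left hexp1 (by positivity)
    _ ≤ E₁ * E₂ * ((A * Real.exp (-((1 - ε) * Real.sqrt m2 * ‖WithLp.toLp 2 (fun μ => ((v μ : ℤ) : ℝ))‖))) * Real.exp A) := by
        gcongr
    _ = E₁ * E₂ * (A * Real.exp A * Real.exp (-((1 - ε) * Real.sqrt m2 * ‖WithLp.toLp 2 (fun μ => ((v μ : ℤ) : ℝ))‖))) := by ring

/-- ★★ **MIXING**: along the cofinite filter of translations `v ∈ ℤ^{d+1}`, `∫e^{φ(f)}e^{φ(T_vg)}dμ_∞ → ∫e^{φ(f)}dμ_∞·∫e^{φ(g)}dμ_∞`. [cite: King1986, Thm 3.3 (3.6) p.655, Thm 2.1 (2.22) p.654] -/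
theorem tendsto_cov_exp_shift {m2 : ℝ} (hm : 0 < m2) (T : Finset J) (p : J → Fin (d + 1) → ℤ) (c : J → ℝ) (T' : Finset J') (p' : J' → Fin (d + 1) → ℤ) (c' : J' → ℝ) :
    Tendsto (fun v : Fin (d + 1) → ℤ => ∫ ω, Real.exp (∑ j ∈ T, c j * ω (p j)) * Real.exp (∑ k ∈ T', c' k * ω (p' k + v)) ∂kingFieldInf m2) cofinite
      (𝓝 ((∫ ω, Real.exp (∑ j ∈ T, c j * ω (p j)) ∂kingFieldInf m2) * (∫ ω, Real.exp (∑ k ∈ T', c' k * ω (p' k)) ∂kingFieldInf m2))) := by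
  have hm' : 0 < Real.sqrt m2 := Real.sqrt_pos.mpr hm
  -- the bound with `ε = 1∕2` tends to `0`
  have hb := abs_cov_exp_shift_le hm (by norm_num : (0 : ℝ) < 1 / 2) (by norm_num : (1 : ℝ) / 2 ≤ 1) T p c T' p' c'
  set B : ℝ := Real.exp ((∑ j ∈ T, ∑ k ∈ T, c j * c k * kingS2Inf m2 (p k - p j)) / 2) * Real.exp ((∑ j ∈ T', ∑ k ∈ T', c' j * c' k * kingS2Inf m2 (p' k - p' j)) / 2)
        * ((∑ j ∈ T, ∑ k ∈ T', |c j| * |c' k| * (Real.exp ((1 - 1 / 2) * Real.sqrt m2 * (1 + Real.sqrt (d + 1))) * (freePropRadial d (1 / 2 * m2) (Real.sqrt (1 / 2)) + m2⁻¹))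
              * Real.exp ((1 - 1 / 2) * Real.sqrt m2 * ‖WithLp.toLp 2 (fun μ => (((p j - p' k) μ : ℤ) : ℝ))‖))
          * Real.exp (∑ j ∈ T, ∑ k ∈ T', |c j| * |c' k| * (Real.exp ((1 - 1 / 2) * Real.sqrt m2 * (1 + Real.sqrt (d + 1))) * (freePropRadial d (1 / 2 * m2) (Real.sqrt (1 / 2)) + m2⁻¹))
              * Real.exp ((1 - 1 / 2) * Real.sqrt m2 * ‖WithLp.toLp 2 (fun μ => (((p j - p' k) μ : ℤ) : ℝ))‖))) with hB
  have hlim : Tendsto (fun v : Fin (d + 1) → ℤ => B * Real.exp (-((1 - 1 / 2) * Real.sqrt m2 * ‖WithLp.toLp 2 (fun μ => ((v μ : ℤ) : ℝ))‖))) cofinite (𝓝 0) := by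
    rw [show (0 : ℝ) = B * 0 by ring]
    refine Tendsto.const_mul B ?_
    have h1 : Tendsto (fun v : Fin (d + 1) → ℤ => (1 - 1 / 2) * Real.sqrt m2 * ‖WithLp.toLp 2 (fun μ => ((v μ : ℤ) : ℝ))‖) cofinite atTop :=
      tendsto_euclidNorm_cofinite.const_mul_atTop (by positivity)
    exact Real.tendsto_exp_neg_atTop_nhds_zero.comp h1
  rw [tendsto_iff_norm_sub_tendsto_zero]
  refine squeeze_zero (fun v => norm_nonneg _) (fun v => ?_) hlim
  rw [Real.norm_eq_abs]
  have := hb v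
  simpa only [hB, mul_assoc] using this

end Summit.QuantumFields.YangMills.BalabanUVNodes.N15KingModelRung.InfiniteVolume
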